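import Summits.QuantumFields.BalabanUV.Beta.ResolventBoxCertificate

/-!
# Beta / ResolventBoxCertificateTaylor — THE ORDER-m SOCKET of the box certificate: a momentum-DEPENDENT (polynomial) preconditioner and the
# closed-form order-m TAYLOR TAIL of a stencil family on a box (β sub-cell, BINDER-OWNERS row CAP-k, lineage `b2b-balaban-beta-an5`, gen 23;
# answer to OBJECTION G-cap1g10-2 (cap1-g10, journal l.14070; cap-ref #82 R82-c «an5-g23 answers (2) (docstring or order-m socket)»))

THE OBJECTION.  `ResolventBoxCertificate.box_certificate` (gen 22) is the ORDER-0 leaf: a CONSTANT preconditioner `P` and the first-order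
Lipschitz majorant `‖A q − A c‖ ≤ L₁·h`.  cap1-g10 measured that for the cell's `k₀` this forces `h ≤ 2·10⁻⁵` at the worst corner, i.e. `≥ 5.8·10¹⁴`
leaves per face — the (Z2)-direct design of CAP-KERNEL §4.22 (a), dead.  A usable leaf needs a preconditioner that FOLLOWS `k₀(q)⁻¹` across the box
(its order-m Taylor polynomial, computed by the engine) and an order-m′ TAYLOR TAIL of the stencil family in closed form.  This module is that socket:

* §1 `box_certificate_of_residual` — Krawczyk POINTWISE on the box with a `q`-dependent preconditioner: `‖1 − P(q)·A(q)‖ ≤ θ < 1` and `‖P(q)‖ ≤ p`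
  on the box ⟹ `IsUnit (A q).det ∧ ‖(A q)⁻¹‖ ≤ p/(1−θ)` on the box.  (The residual bound is what two Taylor-model engines certify — kit-grade, as
  every (Z2) number.)
* §2 THE ORDER-m TAYLOR FAMILY AND ITS TAIL IN CLOSED FORM: on a box `Box c h` (equal imaginary parts, `|Re q_μ − Re c_μ| ≤ h_μ`) each character is
  `χ_q(x) = χ_c(x)·e^{it}` with the REAL phase increment `t = Σ_μ x_μ (Re q_μ − Re c_μ)`, `|t| ≤ Σ_μ |x_μ| h_μ`; replacing `e^{it}` by its Taylor
  polynomial `Σ_{k<m} (it)^k/k!` gives the family `taylorFamily m S K c` and, for `Σ_μ |x_μ| h_μ ≤ 1` on the support, the TAIL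
  `‖A q − taylorFamily m S K c q‖ ≤ taylorTail m S K c h := Σ_{x∈S} e^{−Σ_μ x_μ Im c_μ}·(Σ_μ |x_μ| h_μ)^m·(m+1)/(m!·m)·‖K[x]‖`
  (`norm_characterSum_sub_taylorFamily_le`; Mathlib's `Complex.exp_bound`) — a NUMBER from the typed tables, no engine; `m = 1` is gen 22's
  Lipschitz leaf up to the factor 2.
* §3 **`box_certificate_taylor`** — the ORDER-m LEAF: engine data `P` (any preconditioner family; its sup `p` on the box — for a polynomial
  `P(q) = Σ_β P_β δ(q)^β` the kernel bound `Σ_β ‖P_β‖ h^β`, `norm_polyEval_le`) and the residual-against-the-Taylor-family bound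
  `‖1 − P(q)·taylorFamily(q)‖ ≤ ε` on the box (a polynomial in `δ`, bounded by the engine from its collected coefficients), the kernel's tail
  `taylorTail`, and the checks `ε + p·taylorTail ≤ θ < 1`, `p/(1−θ) ≤ B` ⟹ `IsUnit (A q).det ∧ ‖(A q)⁻¹‖ ≤ B` on the box — the SAME per-leaf
  conclusion `ResolventBoxCertificate.of_cover` ∕ `hBa_of_boxes_negConjRegion` ∕ `TubeZeroFreeSymmetry.det_ne_zero_vertexTori_of_boxes_negConjRegion`
  consume, so (Z2a) AND (F) follow from an order-m cover unchanged.
* §4 polynomial families on a box: `monomial`, `polyEval`, `norm_polyEval_le`.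

WHAT STAYS OUTSIDE THE KERNEL (honest division of labour): the COLLECTED coefficients of the residual polynomial `1 − P·T` (cancellation between
`P ≈ T⁻¹` and `T` is visible only after collection; a non-commutative multivariate polynomial identity of 744² matrices is not kernel-checkable at
the cell's sizes) — hence `ε` is an engine number (two implementations), exactly like `θ₀` of the order-0 leaf; the box SIZE this buys is cap1's
to measure (G-cap1g10-2: «leaves 4e5–2e6 at h ≈ 0.1–0.15, m = 8»; not asserted here).

HONEST FRAMING.  Kernel glue ([folklore]); no box, no preconditioner, no number supplied; 0 binders instantiated.  Discharging `BetaPertH` would make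
Bałaban's ultraviolet stability unconditional — NOT the continuum limit, NOT the Clay problem.  0 `sorry`, 0 cite tags.
-/

namespace Summit.QuantumFields.BalabanUV.Beta.ResolventBoxCertificate

open Complex Set Matrix Finset
open Summit.QuantumFields.BalabanUV.Beta.PolyRegularAlgebra (character)
open scoped Real Matrix.Norms.L2Operator

noncomputable section

variable {d : ℕ} {n : Type*} [Fintype n] [DecidableEq n]

/-! ## §1 Krawczyk pointwise on a box with a momentum-dependent preconditioner -/

/-- **RESIDUAL SOCKET**: a preconditioner FAMILY `P(q)` with `‖1 − P(q)·A(q)‖ ≤ θ < 1` and `‖P(q)‖ ≤ p` on the box ⟹ `A q` invertible with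
`‖(A q)⁻¹‖ ≤ B` for any `B ≥ p/(1−θ)`, on the whole box. [folklore] -/
theorem box_certificate_of_residual {A P : (Fin (d + 1) → ℂ) → Matrix n n ℂ} {c : Fin (d + 1) → ℂ} {h : Fin (d + 1) → ℝ}
    {θ p B : ℝ} (hres : ∀ q ∈ Box c h, ‖1 - P q * A q‖ ≤ θ) (hθ1 : θ < 1) (hP : ∀ q ∈ Box c h, ‖P q‖ ≤ p)
    (hB : p / (1 - θ) ≤ B) : ∀ q ∈ Box c h, IsUnit (A q).det ∧ ‖(A q)⁻¹‖ ≤ B := by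
  intro q hq
  obtain ⟨hU, hN⟩ := krawczyk (hres q hq) hθ1
  refine ⟨hU, hN.trans ((div_le_div_of_nonneg_right (hP q hq) (by linarith)).trans hB)⟩

/-! ## §2 The order-m Taylor family of a stencil family on a box and its closed-form tail -/

/-- the REAL PHASE INCREMENT of the character `x` between the centre `c` and `q`: `Σ_μ x_μ (Re q_μ − Re c_μ)`. [folklore] -/
def phaseIncr (x : Fin (d + 1) → ℤ) (c q : Fin (d + 1) → ℂ) : ℝ := ∑ μ, (x μ : ℝ) * ((q μ).re - (c μ).re)

/-- on a box the phase increment is bounded by `Σ_μ |x_μ| h_μ`. [folklore] -/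
theorem abs_phaseIncr_le (x : Fin (d + 1) → ℤ) {c q : Fin (d + 1) → ℂ} {h : Fin (d + 1) → ℝ} (hq : q ∈ Box c h) :
    |phaseIncr x c q| ≤ ∑ μ, |(x μ : ℝ)| * h μ :=
  abs_sum_mul_sub_le x fun μ => (hq μ).1

/-- with equal imaginary parts `χ_q(x) = χ_c(x)·e^{i·phaseIncr}`. [folklore] -/
theorem character_eq_mul_exp_phaseIncr (x : Fin (d + 1) → ℤ) {c q : Fin (d + 1) → ℂ} (him : ∀ μ, (q μ).im = (c μ).im) :
    character x q = character x c * cexp (I * (phaseIncr x c q : ℂ)) := by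
  rw [character_eq_polar, character_eq_polar]
  simp only [him]
  rw [mul_assoc, ← Complex.exp_add]
  congr 2
  simp only [phaseIncr]
  push_cast
  rw [Finset.mul_sum, Finset.mul_sum, Finset.mul_sum, ← Finset.sum_add_distrib]
  exact Finset.sum_congr rfl fun μ _ => by ring

/-- the norm of a character: `‖χ_c(x)‖ = e^{−Σ_μ x_μ Im c_μ}`. [folklore] -/
theorem norm_character_eq (x : Fin (d + 1) → ℤ) (c : Fin (d + 1) → ℂ) :
    ‖character x c‖ = Real.exp (-(∑ μ, (x μ : ℝ) * (c μ).im)) := by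
  rw [character_eq_polar, norm_mul, Complex.norm_real, Real.norm_of_nonneg (Real.exp_pos _).le, Complex.norm_exp_I_mul_ofReal,
    mul_one]

/-- THE ORDER-m TAYLOR CHARACTER: `χ_c(x) · Σ_{k<m} (i·phaseIncr)^k / k!`. [folklore] -/
def charTaylor (m : ℕ) (x : Fin (d + 1) → ℤ) (c q : Fin (d + 1) → ℂ) : ℂ :=
  character x c * ∑ k ∈ range m, (I * (phaseIncr x c q : ℂ)) ^ k / (k.factorial : ℂ)

/-- THE ORDER-m TAYLOR FAMILY of the stencil family `q ↦ Σ_{x∈S} χ_q(x)·K[x]` around the centre `c`. [folklore] -/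
def taylorFamily (m : ℕ) (S : Finset (Fin (d + 1) → ℤ)) (K : (Fin (d + 1) → ℤ) → Matrix n n ℂ) (c q : Fin (d + 1) → ℂ) :
    Matrix n n ℂ :=
  ∑ x ∈ S, charTaylor m x c q • K x

/-- the Taylor tail factor `t^m · (m+1)/(m!·m)` of Mathlib's `Complex.exp_bound`. [folklore] -/
def tailFactor (m : ℕ) (t : ℝ) : ℝ := t ^ m * (((m + 1 : ℕ) : ℝ) * ((m.factorial : ℝ) * m)⁻¹)

/-- the tail factor is monotone in `t ≥ 0`. [folklore] -/
theorem tailFactor_mono (m : ℕ) {s t : ℝ} (hs : 0 ≤ s) (hst : s ≤ t) : tailFactor m s ≤ tailFactor m t := by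
  unfold tailFactor
  refine mul_le_mul_of_nonneg_right (pow_le_pow_left₀ hs hst m) ?_
  positivity

/-- ONE CHARACTER: `‖χ_q(x) − charTaylor m x c q‖ ≤ e^{−Σ_μ x_μ Im c_μ} · tailFactor m |phaseIncr|` when `|phaseIncr| ≤ 1`, `0 < m`. [folklore] -/
theorem norm_character_sub_charTaylor_le {m : ℕ} (hm : 0 < m) (x : Fin (d + 1) → ℤ) {c q : Fin (d + 1) → ℂ}
    (him : ∀ μ, (q μ).im = (c μ).im) (ht : |phaseIncr x c q| ≤ 1) :
    ‖character x q - charTaylor m x c q‖ ≤ Real.exp (-(∑ μ, (x μ : ℝ) * (c μ).im)) * tailFactor m |phaseIncr x c q| := by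
  rw [character_eq_mul_exp_phaseIncr x him, charTaylor, ← mul_sub, norm_mul, norm_character_eq]
  refine mul_le_mul_of_nonneg_left ?_ (Real.exp_pos _).le
  have hx : ‖I * (phaseIncr x c q : ℂ)‖ ≤ 1 := by simpa using ht
  have hb := Complex.exp_bound hx hm
  have e : ‖I * (phaseIncr x c q : ℂ)‖ = |phaseIncr x c q| := by simp
  rw [e] at hb
  simpa [tailFactor] using hb

/-- THE CLOSED-FORM ORDER-m TAIL of the stencil family on the box `Box c h`. [folklore] -/
def taylorTail (m : ℕ) (S : Finset (Fin (d + 1) → ℤ)) (K : (Fin (d + 1) → ℤ) → Matrix n n ℂ) (c : Fin (d + 1) → ℂ)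
    (h : Fin (d + 1) → ℝ) : ℝ :=
  ∑ x ∈ S, Real.exp (-(∑ μ, (x μ : ℝ) * (c μ).im)) * tailFactor m (∑ μ, |(x μ : ℝ)| * h μ) * ‖K x‖

/-- **THE ORDER-m TAYLOR TAIL ON A BOX**: for `q ∈ Box c h`, `0 < m`, and `Σ_μ |x_μ| h_μ ≤ 1` on the support,
`‖Σ_x χ_q(x)K[x] − taylorFamily m S K c q‖ ≤ taylorTail m S K c h`. [folklore] -/
theorem norm_characterSum_sub_taylorFamily_le {m : ℕ} (hm : 0 < m) (S : Finset (Fin (d + 1) → ℤ))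
    (K : (Fin (d + 1) → ℤ) → Matrix n n ℂ) {c q : Fin (d + 1) → ℂ} {h : Fin (d + 1) → ℝ} (hq : q ∈ Box c h)
    (hsmall : ∀ x ∈ S, ∑ μ, |(x μ : ℝ)| * h μ ≤ 1) :
    ‖(∑ x ∈ S, character x q • K x) - taylorFamily m S K c q‖ ≤ taylorTail m S K c h := by
  rw [taylorFamily, ← Finset.sum_sub_distrib, taylorTail]
  refine (norm_sum_le _ _).trans (Finset.sum_le_sum fun x hx => ?_)
  rw [← sub_smul]
  refine (norm_smul_le _ _).trans ?_
  have hphase := abs_phaseIncr_le x hq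
  have h1 := norm_character_sub_charTaylor_le hm x (fun μ => (hq μ).2) (hphase.trans (hsmall x hx))
  refine mul_le_mul_of_nonneg_right (h1.trans ?_) (norm_nonneg _)
  exact mul_le_mul_of_nonneg_left (tailFactor_mono m (abs_nonneg _) hphase) (Real.exp_pos _).le

/-! ## §3 The order-m leaf -/

/-- **THE ORDER-m BOX CERTIFICATE** (one leaf).  ENGINE DATA: a preconditioner family `P` (typically the order-m Taylor polynomial of `A(q)⁻¹` at
`c` in the box displacement), its sup `p` on the box, and the bound `ε` of the RESIDUAL AGAINST THE TAYLOR FAMILY `‖1 − P(q)·taylorFamily m S K c q‖`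
on the box; KERNEL: the tail `taylorTail m S K c h`; CHECKS: `ε + p·taylorTail ≤ θ < 1`, `p/(1−θ) ≤ B`.  THEN on the whole box
`IsUnit (A q).det ∧ ‖(A q)⁻¹‖ ≤ B` for `A q = Σ_{x∈S} χ_q(x)·K[x]` — the per-leaf conclusion of `of_cover`. [folklore] -/
theorem box_certificate_taylor {m : ℕ} (hm : 0 < m) (S : Finset (Fin (d + 1) → ℤ)) (K : (Fin (d + 1) → ℤ) → Matrix n n ℂ)
    {c : Fin (d + 1) → ℂ} {h : Fin (d + 1) → ℝ} (hsmall : ∀ x ∈ S, ∑ μ, |(x μ : ℝ)| * h μ ≤ 1)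
    {P : (Fin (d + 1) → ℂ) → Matrix n n ℂ} {ε p θ B : ℝ}
    (hE : ∀ q ∈ Box c h, ‖1 - P q * taylorFamily m S K c q‖ ≤ ε) (hP : ∀ q ∈ Box c h, ‖P q‖ ≤ p) (hp : 0 ≤ p)
    (hθ : ε + p * taylorTail m S K c h ≤ θ) (hθ1 : θ < 1) (hB : p / (1 - θ) ≤ B) :
    ∀ q ∈ Box c h, IsUnit (∑ x ∈ S, character x q • K x).det ∧ ‖(∑ x ∈ S, character x q • K x)⁻¹‖ ≤ B := by
  refine box_certificate_of_residual (A := fun q => ∑ x ∈ S, character x q • K x) (fun q hq => ?_) hθ1 hP hB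
  have e : (1 : Matrix n n ℂ) - P q * ∑ x ∈ S, character x q • K x
      = (1 - P q * taylorFamily m S K c q) - P q * ((∑ x ∈ S, character x q • K x) - taylorFamily m S K c q) := by
    rw [Matrix.mul_sub]; abel
  rw [e]
  calc ‖(1 - P q * taylorFamily m S K c q) - P q * ((∑ x ∈ S, character x q • K x) - taylorFamily m S K c q)‖
      ≤ ‖1 - P q * taylorFamily m S K c q‖ + ‖P q * ((∑ x ∈ S, character x q • K x) - taylorFamily m S K c q)‖ := norm_sub_le _ _
    _ ≤ ε + ‖P q‖ * ‖(∑ x ∈ S, character x q • K x) - taylorFamily m S K c q‖ := add_le_add (hE q hq) (l2_opNorm_mul _ _)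
    _ ≤ ε + p * taylorTail m S K c h := by
        gcongr
        · exact hP q hq
        · exact norm_characterSum_sub_taylorFamily_le hm S K hq hsmall
    _ ≤ θ := hθ

/-! ## §4 Polynomial families on a box: the preconditioner's sup from its coefficient norms -/

/-- the box displacement `δ(q)_μ = Re q_μ − Re c_μ`. [folklore] -/
def boxDisp (c q : Fin (d + 1) → ℂ) : Fin (d + 1) → ℝ := fun μ => (q μ).re - (c μ).re

/-- a real monomial `δ^β = Π_μ δ_μ^{β_μ}`. [folklore] -/
def monomial (β : Fin (d + 1) → ℕ) (δ : Fin (d + 1) → ℝ) : ℝ := ∏ μ, δ μ ^ β μ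

/-- on a box `|δ^β| ≤ h^β`. [folklore] -/
theorem abs_monomial_le (β : Fin (d + 1) → ℕ) {δ h : Fin (d + 1) → ℝ} (hδ : ∀ μ, |δ μ| ≤ h μ) :
    |monomial β δ| ≤ monomial β h := by
  rw [monomial, monomial, Finset.abs_prod]
  refine Finset.prod_le_prod (fun μ _ => abs_nonneg _) fun μ _ => ?_
  rw [abs_pow]
  exact pow_le_pow_left₀ (abs_nonneg _) (hδ μ) _

/-- a matrix POLYNOMIAL FAMILY in the box displacement: `Σ_{β∈T} δ^β · C_β`. [folklore] -/
def polyEval (T : Finset (Fin (d + 1) → ℕ)) (C : (Fin (d + 1) → ℕ) → Matrix n n ℂ) (δ : Fin (d + 1) → ℝ) : Matrix n n ℂ :=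
  ∑ β ∈ T, ((monomial β δ : ℝ) : ℂ) • C β

/-- **THE SUP OF A POLYNOMIAL FAMILY ON A BOX FROM ITS COEFFICIENT NORMS**: `‖Σ_β δ^β C_β‖ ≤ Σ_β h^β ‖C_β‖` for `|δ_μ| ≤ h_μ`. [folklore] -/
theorem norm_polyEval_le (T : Finset (Fin (d + 1) → ℕ)) (C : (Fin (d + 1) → ℕ) → Matrix n n ℂ) {δ h : Fin (d + 1) → ℝ}
    (hδ : ∀ μ, |δ μ| ≤ h μ) : ‖polyEval T C δ‖ ≤ ∑ β ∈ T, monomial β h * ‖C β‖ := by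
  refine (norm_sum_le _ _).trans (Finset.sum_le_sum fun β _ => ?_)
  refine (norm_smul_le _ _).trans ?_
  rw [Complex.norm_real, Real.norm_eq_abs]
  exact mul_le_mul_of_nonneg_right (abs_monomial_le β hδ) (norm_nonneg _)

/-- the preconditioner hypothesis `hP` of `box_certificate_taylor` for a polynomial preconditioner, from coefficient norms. [folklore] -/
theorem norm_polyEval_boxDisp_le (T : Finset (Fin (d + 1) → ℕ)) (C : (Fin (d + 1) → ℕ) → Matrix n n ℂ)
    {c : Fin (d + 1) → ℂ} {h : Fin (d + 1) → ℝ} {p : ℝ} (hp : ∑ β ∈ T, monomial β h * ‖C β‖ ≤ p) :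
    ∀ q ∈ Box c h, ‖polyEval T C (boxDisp c q)‖ ≤ p :=
  fun _ hq => (norm_polyEval_le T C fun μ => (hq μ).1).trans hp

end

end Summit.QuantumFields.BalabanUV.Beta.ResolventBoxCertificate
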